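import Summits.BirchSwinnertonDyer.BirchSwinnertonDyer.Theorems.KatoDescentPotSupersingularASideCountSharp
import Summits.BirchSwinnertonDyer.BirchSwinnertonDyer.Theorems.KatoDescentPotSupersingularMemberHullZetaInputsOfCore
import Summits.BirchSwinnertonDyer.BirchSwinnertonDyer.Theorems.KatoDescentPotSupersingularMemberHullZetaCoreInputsOfKummer
import Summits.BirchSwinnertonDyer.BirchSwinnertonDyer.Theorems.PoitouTateSelmerStructureDualityConjHolds
import Summits.BirchSwinnertonDyer.BirchSwinnertonDyer.Theorems.KatoDescentPotSupersingularReducibleUpperOfCountInputsNodes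
import HarnessLib

/-!
# U₀-red from crux M's held CORE package, ROUTE-FREE part: Kato's member count with `2·ord_p #tors` from `MemberHullZetaCoreInputs` + Poitou–Tate
# (a theorem), hence `ord_p #Ш(W_K) + v_p Tam(W_K) ≤ ord_p(L(W_K,1)/Ω(W_K)) + 2·ord_p #W_K(ℚ)_tors` at Kato's member and `MissingUpperBoundAt W p` on
# every reducible additive potentially good row of analytic rank `0` from `{nonempty_iwasawaH1Data, exists_isNewformOf, exists_memberHullZetaCoreInputs,
# Cassels, GZK, modularity}` — ONE Kato input for M and U₀-red (planner TARGET R283, question Q-U0red; route-free module, no `Theses` import)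

Seat `bsd-potss-rkm` g24 (prover; cell `bsd-potss`; `--supports …`; closes nothing by itself).  HONEST FRAMING: BSD is not proved by any of this;
nothing is booked; theorems only (no definition, no named fact).  The named facts `Kato2004.exists_memberHullZetaCoreInputs` (p630270; implied in
the kernel by the print-exact Kummer package `exists_memberHullZetaKummerCoreInputs`, p637289/p638165), `nonempty_iwasawaH1Data`,
`exists_isNewformOf`, Cassels, GZK, modularity are HYPOTHESES; `poitouTate_selmerStructure_duality ℚ` is DISCHARGED (tree theorem,
`CoreInputsNoPT.poitouTate_selmerStructure_duality_rat`).

## Answer to Q-U0red (TARGET R283)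

The held COUNT package `exists_memberHullCountInputs` (child 19707 of U₀-red) is consumed by the routes only through the member inequality
`ord Ш + v Tam ≤ ord q + 2t` (`MemberCountInputs.sha_add_tamagawa_le`, `ReducibleUpperOfCountInputsNodes`).  That inequality IS a kernel
consequence of the CORE package: the level-0 ledger re-run with the sharp companion (ii) (this session's parts
`…H1TateTorsionKummer`, `…UnramifiedLevelRaise`, `…KatoSelmerPTCokernelSharp`, `…KatoSelmerPTCokernelTorsion`, `…ASideLedgerSharp`,
`…ASideCountSharp`) gives Kato's Prop. 14.16 (2) count at the member with `2·ord_p #W(ℚ)_tors` (not `3·`), and the PROVED hull descent closes.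
(The count-value SHELL itself — abstract `S`, `Sel` with (C1), (C2) separately — is equivalent to the EXACT count and is not claimed.)

## What

* `MemberHullZetaCoreInputs.count_sharp_of_PT` — on every pin with `W(ℚ)`, `Ш(W)[p^∞]` finite (`p` odd, `κ` cyclotomic, `γ` a generator,
  PT): `ord_p #Ш(W)[p^∞] + v_p Tam(W) + ord_p [A : Λ·ι(𝐲̄)] ≤ ord_p(L(W,1)/Ω) + v_p λ(0) + ord_p #(𝐇²/X𝐇²) + 2·ord_p #W(ℚ)_tors`;
* `MemberHullZetaCoreInputs.sha_add_tamagawa_le_of_PT` — with the proved hull descent: `ord_p #Ш(W)[p^∞] + v_p Tam(W) ≤ ord_p(L(W,1)/Ω) + 2·ord_p #W(ℚ)_tors`;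
* `katoMemberShaBoundSharp_of_coreInputs`, `missingUpperBoundAt_of_coreInputs` — the fact-level member bound and the UPPER half
  `MissingUpperBoundAt W p` on every reducible additive potentially good row of analytic rank `0` (Cassels' transport), from the CORE fact;
* `missingUpperBoundAt_of_coreInputs'` / `missingUpperBoundAt_of_kummerCoreInputs` — the upper half with PT DISCHARGED (the tree theorem
  `InputsPoitouTateSelmer.poitouTate_selmerStructure_duality_conj_holds ℚ` + `poitouTate_selmerStructure_duality_of_conj`), from the core / the
  PRINT-EXACT Kummer package.  The route decls 19190 / 19203 follow in the companion file `…ReducibleUpperOfCoreInputsGlue` (which imports the routes).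

References: K. Kato, Astérisque 295 (2004), Thm. 14.5 (2) (p. 236), §14.8 (p. 238), (14.9.3) (p. 240), §14.14–Lemma 14.15 (pp. 243–244), Prop. 14.16
and its proof (pp. 244–245), Lemma 14.18 (pp. 247–248) [Kato2004Asterisque]; R. Greenberg, LNM 1716 (1999), §3, appendix to §4 [GreenbergLNM1716];
J. S. Milne, *ADT* I Cor. 2.3, Thm. 2.6, Thm. 4.10 (b) [MilneADT2006]; J. W. S. Cassels, Arithmetic VIII (1965) [Cassels1965ArithmeticVIII];
R. L. Miller, LMS JCM 14 (2011) Def. 1.1 [Miller2011LMS]; C. Wuthrich, Doc. Math. 19 (2014) Lemma 14 [Wuthrich2014].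
-/

-- the summit and its single problem are both named `BirchSwinnertonDyer` (registry layout D-0017)
set_option linter.dupNamespace false
set_option autoImplicit false

noncomputable section

open scoped Classical ContRepresentation NumberField TensorProduct
open CategoryTheory Function Field NumberField IsDedekindDomain WeierstrassCurve CongruenceSubgroup
open Literature.NumberTheory.EllipticCurves Literature.NumberTheory.GaloisRepresentations
  Literature.NumberTheory.GaloisRepresentations.DiscreteGaloisModule Literature.NumberTheory.GaloisCohomology
open Literature.NumberTheory.EllipticCurves.ModularForms
open Literature.NumberTheory.EllipticCurves.Kato2004 Literature.NumberTheory.EllipticCurves.Kato2004.EulerSystemValues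
open Literature.NumberTheory.EllipticCurves.IwasawaAlgebra Rat.HeightOneSpectrum
open Literature.NumberTheory.EllipticCurves.Rank1Residual Literature.NumberTheory.EllipticCurves.Rank1Residual.Typed
open Summit.BirchSwinnertonDyer.Rank1Residual.X11b.Levels Summit.BirchSwinnertonDyer.Rank1Residual.X11b.LocBridge
  Summit.BirchSwinnertonDyer.Rank1Residual.X11b.AcSelmer
open Summit.BirchSwinnertonDyer.Rank1Residual Summit.BirchSwinnertonDyer.Rank1Residual.Additive
open Summit.BirchSwinnertonDyer.BirchSwinnertonDyer.Theorems.ASideJunction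
open Summit.BirchSwinnertonDyer.BirchSwinnertonDyer.Theorems.KatoFiniteLevelCount
open Summit.BirchSwinnertonDyer.BirchSwinnertonDyer.Theorems.StrictSelmerBridge
open Summit.BirchSwinnertonDyer.BirchSwinnertonDyer.Theorems.IntegralH1LayerZeroTop
open Summit.BirchSwinnertonDyer.BirchSwinnertonDyer.Theorems.MemberIndexOfValue
open Summit.BirchSwinnertonDyer.BirchSwinnertonDyer.Theorems.MemberHullZetaInputsOfCore

namespace Summit.BirchSwinnertonDyer.BirchSwinnertonDyer.Theorems.ReducibleUpperOfCoreInputs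

/-! ## §1 The sharp count on a core package -/

section Core

variable {W : WeierstrassCurve ℚ} [W.IsElliptic] {p : ℕ} [Fact p.Prime]
  [ContinuousSMul ℤ_[p] (W.tateModule p)] {κ : ZpExtension ℚ p} {γ : absoluteGaloisGroup ℚ}
  {I : IwasawaH1Data W p κ γ} {y : I.H}

variable [Finite W.toAffine.Point] [Finite (AddCommGroup.primaryComponent W.sha p)]

/-- **Prop. 14.16 (2) — the SHARP count — on a core package** (`W(ℚ)`, `Ш[p^∞]` finite; `p` odd; `κ` cyclotomic, `γ` a generator; the named fact
`poitouTate_selmerStructure_duality ℚ`):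
`ord_p #Ш(W)[p^∞] + v_p(Tam W) + ord_p [A : Λ·ι(𝐲̄)] ≤ ord_p(L(W,1)/Ω(W)) + v_p(λ(0)) + ord_p #(𝐇²/X𝐇²) + 2·ord_p #W(ℚ)_tors` — g21's
`count_of_zetaLineIndex_of_katoH2Count` with part 58 replaced by the SHARP level-0 count (`tamagawa_mul_sha_mul_index_le_sharp_of_zetaLineOrthIndexAt`,
one torsion power); (b′) `zetaLineIndex` and (c2′) `katoH2Count` consumed exactly as there.
[cite: Kato2004Asterisque, Prop. 14.16 (2) and its proof (pp. 244–245), (14.9.3) (p. 240), (14.14.2) (p. 243), Lemma 14.18 (pp. 247–248)]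
[cite: GreenbergLNM1716, appendix to §4] [cite: MilneADT2006, Ch. I, Cor. 2.3, Thm. 2.6, Thm. 4.10 (b)] -/
theorem _root_.Literature.NumberTheory.EllipticCurves.Kato2004.MemberHullZetaCoreInputs.count_sharp_of_PT
    (Z : MemberHullZetaCoreInputs W p κ γ I y) (hκ : κ.IsCyclotomic) (hγ : κ.IsTopGenerator γ)
    (hPT : poitouTate_selmerStructure_duality ℚ) (hodd : p ≠ 2) :
    ∃ q : ℚ, W.entireLFunction 1 / (W.realPeriodRat : ℂ) = (q : ℂ) ∧
      (padicValNat p (Nat.card (AddCommGroup.primaryComponent W.sha p)) : ℤ) +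
          padicValNat p W.tamagawaProduct +
          padicValNat p (Nat.card (Z.A ⧸ (IwasawaAlgebra p) ∙ Z.ι (Submodule.Quotient.mk y))) ≤
        padicValRat p q + ((PowerSeries.constantCoeff Z.lam).valuation : ℤ) +
          padicValNat p (Nat.card (coinvariants p Z.H2)) + 2 * (padicValNat p W.torsionOrder : ℤ) := by
  have hp : p.Prime := Fact.out
  obtain ⟨D, hDH2, -, hDA, hDH2card⟩ := Z.exists_iwasawaH2Data hκ hγ
  obtain ⟨q, hq, e, he, hZL⟩ := Z.zetaLineIndex
  refine ⟨q, hq, ?_⟩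
  -- the zeta line at `⊤`
  set y₀ : H1 (tateRep W p) ⊤ := layerZeroToTop W p κ (I.proj 0 y) with hy₀def
  have hy₀ : y₀ ∈ integralH1 (tateRep W p) p ⊤ := layerZeroToTop_mem_integralH1 W p κ (I.proj_mem 0 y)
  -- the index `[A : Λ·ι(𝐲̄)] = [integralH1_⊤ : ℤ_p y₀] ≠ 0`
  have hidx : Nat.card (Z.A ⧸ (IwasawaAlgebra p) ∙ Z.ι (Submodule.Quotient.mk y)) ≠ 0 := Z.index_ne_zero_of_PT hκ hγ hPT
  have hrel : Nat.card (Z.A ⧸ (IwasawaAlgebra p) ∙ Z.ι (Submodule.Quotient.mk y)) =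
      (ℤ_[p] ∙ y₀).toAddSubgroup.relIndex (integralH1 (tateRep W p) p ⊤).toAddSubgroup := by
    rw [← hDA]; exact IwasawaH2Data.natCard_quotient_eq_relIndex_top D y
  have hrel0 : (ℤ_[p] ∙ y₀).toAddSubgroup.relIndex (integralH1 (tateRep W p) p ⊤).toAddSubgroup ≠ 0 := hrel ▸ hidx
  obtain ⟨N, hN⟩ := exists_pow_smul_mem_span_singleton_of_relIndex_ne_zero (integralH1 (tateRep W p) p ⊤) y₀ hy₀ hrel0
  -- the strict-unramified and relaxed-unramified structures, the finite set of bad places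
  obtain ⟨𝓢inf, hSp, hSur, hSinl⟩ : ∃ 𝓢 : SelmerStructure (primaryGaloisModule W p),
      𝓢 (Sum.inr (primePlace p)) = ⊥ ∧
      (∀ v : HeightOneSpectrum (𝓞 ℚ), v ≠ primePlace p →
        𝓢 (Sum.inr v) = unramifiedSubgroup (GaloisRep.toLocal v (primaryGaloisModule W p)) 1) ∧
      ∀ w : InfinitePlace ℚ, 𝓢 (Sum.inl w) = ⊤ :=
    ⟨fun v => match v with
      | Sum.inl _ => ⊤
      | Sum.inr v => if v = primePlace p then ⊥ else unramifiedSubgroup (GaloisRep.toLocal v (primaryGaloisModule W p)) 1,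
     if_pos rfl, fun v hv => if_neg hv, fun _ => rfl⟩
  obtain ⟨𝓤inf, hUp, hUur, hUinl⟩ : ∃ 𝓤 : SelmerStructure (primaryGaloisModule W p),
      𝓤 (Sum.inr (primePlace p)) = ⊤ ∧
      (∀ v : HeightOneSpectrum (𝓞 ℚ), v ≠ primePlace p →
        𝓤 (Sum.inr v) = unramifiedSubgroup (GaloisRep.toLocal v (primaryGaloisModule W p)) 1) ∧
      ∀ w : InfinitePlace ℚ, 𝓤 (Sum.inl w) = ⊤ :=
    ⟨fun v => match v with
      | Sum.inl _ => ⊤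
      | Sum.inr v => if v = primePlace p then ⊤ else unramifiedSubgroup (GaloisRep.toLocal v (primaryGaloisModule W p)) 1,
     if_pos rfl, fun v hv => if_neg hv, fun _ => rfl⟩
  obtain ⟨S, hS⟩ : ∃ S : Finset (HeightOneSpectrum (𝓞 ℚ)), ∀ v, v ∉ S → W.HasGoodReductionAt v := by
    have h := WeierstrassCurve.eventually_hasGoodReductionAt W
    rw [Filter.eventually_cofinite] at h
    exact ⟨h.toFinset, fun v hv => by_contra fun hbad => hv (h.mem_toFinset.mpr hbad)⟩
  -- the SHARP level-0 count in naturals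
  have h58 := tamagawa_mul_sha_mul_index_le_sharp_of_zetaLineOrthIndexAt W p 𝓤inf 𝓢inf hPT hodd (insert (primePlace p) S)
    (Finset.mem_insert_self _ _) (fun v hv => hS v fun h => hv (Finset.mem_insert_of_mem h)) hUp hUur hUinl hSp hSur hSinl y₀ hy₀ N hN e hZL
  -- part 59 and (c2′)
  have h59 : Nat.card 𝓢inf.selmerGroup = Nat.card (katoStrictSelmer W p {primePlace p}) :=
    natCard_selmerGroup_eq_natCard_katoStrictSelmer W p 𝓢inf hSp hSur hSinl
  have hc2 : Nat.card (coinvariants p Z.H2) * Nat.card (AddCommGroup.primaryComponent W.toAffine.Point p) =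
      Nat.card (katoStrictSelmer W p {primePlace p}) *
        Nat.card (AddCommGroup.primaryComponent (W.baseChange ((primePlace p).adicCompletion ℚ)).toAffine.Point p) := Z.katoH2Count
  -- every factor is a power of `p`
  obtain ⟨s, hs⟩ := natCard_primaryComponent_eq_prime_pow p (G := ↥W.sha)
  obtain ⟨t₀, ht₀⟩ := natCard_primaryComponent_eq_prime_pow p (G := W.toAffine.Point)
  haveI := Summit.BirchSwinnertonDyer.Rank1Residual.X12.O11.finite_primaryComponent_point_adicCompletion W p (primePlace p)
  obtain ⟨tp, htp⟩ := natCard_primaryComponent_eq_prime_pow p (G := (W.baseChange ((primePlace p).adicCompletion ℚ)).toAffine.Point)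
  -- the index is a power of `p`
  have hrelQ : (ℤ_[p] ∙ y₀).toAddSubgroup.relIndex (integralH1 (tateRep W p) p ⊤).toAddSubgroup =
      Nat.card (integralH1 (tateRep W p) p ⊤ ⧸ (ℤ_[p] ∙ (⟨y₀, hy₀⟩ : integralH1 (tateRep W p) p ⊤))) :=
    (natCard_quotient_span_eq_relIndex _ y₀ hy₀).symm
  haveI : Finite (integralH1 (tateRep W p) p ⊤ ⧸ (ℤ_[p] ∙ (⟨y₀, hy₀⟩ : integralH1 (tateRep W p) p ⊤))) :=
    Nat.finite_of_card_ne_zero (hrelQ ▸ hrel0)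
  obtain ⟨i, hi⟩ := natCard_eq_prime_pow_of_finite_module p ℤ_[p]
    (integralH1 (tateRep W p) p ⊤ ⧸ (ℤ_[p] ∙ (⟨y₀, hy₀⟩ : integralH1 (tateRep W p) p ⊤)))
  rw [← hrelQ] at hi
  -- `#Sel_str ≠ 0` (the left-hand side of the sharp count is positive), hence `n = #(𝐇²/X𝐇²) ≠ 0` and `n` is a power of `p`
  have hLHS : 0 < p ^ padicValNat p W.tamagawaProduct * Nat.card (AddCommGroup.primaryComponent (↥W.sha) p) *
      (ℤ_[p] ∙ y₀).toAddSubgroup.relIndex (integralH1 (tateRep W p) p ⊤).toAddSubgroup :=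
    Nat.mul_pos (Nat.mul_pos (pow_pos hp.pos _) Nat.card_pos) (Nat.pos_of_ne_zero hrel0)
  have hSel0 : Nat.card (katoStrictSelmer W p {primePlace p}) ≠ 0 := by
    intro h0
    rw [h59, h0] at h58
    simp only [mul_zero, zero_mul] at h58
    omega
  have hn0 : Nat.card (coinvariants p Z.H2) ≠ 0 := by
    intro h0
    rw [h0, zero_mul] at hc2
    exact (mul_ne_zero hSel0 (htp ▸ pow_ne_zero tp hp.ne_zero)) hc2.symm
  haveI : Finite (coinvariants p Z.H2) := Nat.finite_of_card_ne_zero hn0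
  obtain ⟨ν, hν⟩ := natCard_eq_prime_pow_of_finite_module p (IwasawaAlgebra p) (coinvariants p Z.H2)
  -- the inequality of exponents (ONE torsion power from the ledger)
  have hmain : padicValNat p W.tamagawaProduct + s + i + tp ≤
      padicValNat p ((W.baseChange ((primePlace p).adicCompletion ℚ)).localTamagawaNumber ((primePlace p).adicCompletionIntegers ℚ)) +
        ν + t₀ + e + padicValNat p W.torsionOrder := by
    apply (Nat.pow_le_pow_iff_right hp.one_lt).mp
    have h1 := Nat.mul_le_mul_right (p ^ tp) h58
    rw [h59, hs, hi] at h1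
    calc p ^ (padicValNat p W.tamagawaProduct + s + i + tp)
        = p ^ padicValNat p W.tamagawaProduct * p ^ s * p ^ i * p ^ tp := by simp only [pow_add]
      _ ≤ p ^ padicValNat p ((W.baseChange ((primePlace p).adicCompletion ℚ)).localTamagawaNumber
              ((primePlace p).adicCompletionIntegers ℚ)) * Nat.card (katoStrictSelmer W p {primePlace p}) * p ^ e *
            p ^ padicValNat p W.torsionOrder * p ^ tp := h1
      _ = p ^ padicValNat p ((W.baseChange ((primePlace p).adicCompletion ℚ)).localTamagawaNumber
              ((primePlace p).adicCompletionIntegers ℚ)) * p ^ e * p ^ padicValNat p W.torsionOrder *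
            (Nat.card (katoStrictSelmer W p {primePlace p}) *
              Nat.card (AddCommGroup.primaryComponent (W.baseChange ((primePlace p).adicCompletion ℚ)).toAffine.Point p)) := by
          rw [htp]; ring
      _ = p ^ padicValNat p ((W.baseChange ((primePlace p).adicCompletion ℚ)).localTamagawaNumber
              ((primePlace p).adicCompletionIntegers ℚ)) * p ^ e * p ^ padicValNat p W.torsionOrder * (p ^ ν * p ^ t₀) := by
          rw [← hc2, hν, ht₀]
      _ = p ^ (padicValNat p ((W.baseChange ((primePlace p).adicCompletion ℚ)).localTamagawaNumber
              ((primePlace p).adicCompletionIntegers ℚ)) + ν + t₀ + e + padicValNat p W.torsionOrder) := by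
          simp only [pow_add]; ring
  -- `t₀ ≤ v_p #W(ℚ)_tors`
  have htO : Nat.card (AddCommGroup.torsion W.toAffine.Point) = W.torsionOrder := by
    unfold WeierstrassCurve.torsionOrder; convert rfl
  have ht₀le : t₀ ≤ padicValNat p W.torsionOrder := by
    have hdvd : Nat.card (AddCommGroup.primaryComponent W.toAffine.Point p) ∣ Nat.card (AddCommGroup.torsion W.toAffine.Point) :=
      AddSubgroup.card_dvd_of_le fun x hx => by
        obtain ⟨k, hk⟩ := (AddCommGroup.mem_primaryComponent (p := p)).mp hx
        rw [AddCommGroup.mem_torsion]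
        exact isOfFinAddOrder_iff_nsmul_eq_zero.mpr ⟨p ^ k, pow_pos hp.pos k, hk⟩
    rw [ht₀, htO] at hdvd
    exact (padicValNat_dvd_iff_le (htO ▸ Nat.card_pos.ne')).mp hdvd
  -- the exponents of the package
  have hSha : padicValNat p (Nat.card (AddCommGroup.primaryComponent W.sha p)) = s := by rw [hs, padicValNat.prime_pow]
  have hIdx : padicValNat p (Nat.card (Z.A ⧸ (IwasawaAlgebra p) ∙ Z.ι (Submodule.Quotient.mk y))) = i := by
    rw [hrel, hi, padicValNat.prime_pow]
  have hH2 : padicValNat p (Nat.card (coinvariants p Z.H2)) = ν := by rw [hν, padicValNat.prime_pow]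
  have hTp : padicValNat p (Nat.card (AddCommGroup.primaryComponent
      (W.baseChange ((primePlace p).adicCompletion ℚ)).toAffine.Point p)) = tp := by rw [htp, padicValNat.prime_pow]
  rw [hSha, hIdx, hH2]
  rw [hTp] at he
  push_cast at hmain he ⊢
  have hmain' : (padicValNat p W.tamagawaProduct : ℤ) + s + i + tp ≤
      (padicValNat p ((W.baseChange ((primePlace p).adicCompletion ℚ)).localTamagawaNumber ((primePlace p).adicCompletionIntegers ℚ)) : ℤ) +
        ν + t₀ + e + padicValNat p W.torsionOrder := by exact_mod_cast hmain
  have ht₀le' : (t₀ : ℤ) ≤ padicValNat p W.torsionOrder := by exact_mod_cast ht₀le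
  linarith

/-- **The UPPER half at the pin with NO torsion slack, from a core package**: the sharp count and the PROVED hull descent
(`MemberHullInputs.valuation_add_padicValNat_coinvariants_le` on the `MemberHullInputs` package the core package yields —
`v_p λ(0) + ord_p #(𝐇²/X𝐇²) ≤ ord_p [A : Λ·ι(𝐲̄)]`) give `ord_p #Ш(W)[p^∞] + v_p Tam(W) ≤ ord_p(L(W,1)/Ω(W)) + 2·ord_p #W(ℚ)_tors`
(`#Ш_an = q·#tors²/Tam`: `ord_p #Ш(W) ≤ ord_p #Ш_an(W)`).  [cite: Kato2004Asterisque, Thm. 12.5 (3) (p. 222), §14.14–Lemma 14.15 (pp. 243–244), proof of Prop. 14.16 (pp. 244–245)]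
[cite: Wuthrich2014, Lemma 14 (p. 396)] -/
theorem _root_.Literature.NumberTheory.EllipticCurves.Kato2004.MemberHullZetaCoreInputs.sha_add_tamagawa_le_of_PT
    (Z : MemberHullZetaCoreInputs W p κ γ I y) (hκ : κ.IsCyclotomic) (hγ : κ.IsTopGenerator γ)
    (hPT : poitouTate_selmerStructure_duality ℚ) (hodd : p ≠ 2) :
    ∃ q : ℚ, W.entireLFunction 1 / (W.realPeriodRat : ℂ) = (q : ℂ) ∧
      (padicValNat p (Nat.card (AddCommGroup.primaryComponent W.sha p)) : ℤ) + padicValNat p W.tamagawaProduct ≤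
        padicValRat p q + 2 * (padicValNat p W.torsionOrder : ℤ) := by
  obtain ⟨q, hq, hcount⟩ := Z.count_sharp_of_PT hκ hγ hPT hodd
  -- the `MemberHullInputs` package of the pin (g21: the two dropped clauses are theorems; (R0) for `finite_coinvariants_H2`)
  let P : MemberHullInputs W p κ γ I y :=
    (Z.toMemberHullZetaInputs (Z.index_ne_zero_of_PT hκ hγ hPT) (Z.count_of_zetaLineIndex_of_katoH2Count hκ hγ hPT hodd)).toMemberHullInputs_of_rank_integralH1_le_one
      hκ hγ (IntegralH1RankZero.rank_integralH1_layerZero_le_one W p κ)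
  have hhull : ((PowerSeries.constantCoeff Z.lam).valuation : ℤ) + (padicValNat p (Nat.card (coinvariants p Z.H2)) : ℤ) ≤
      (padicValNat p (Nat.card (Z.A ⧸ (IwasawaAlgebra p) ∙ Z.ι (Submodule.Quotient.mk y))) : ℤ) := by
    exact_mod_cast P.valuation_add_padicValNat_coinvariants_le
  exact ⟨q, hq, by linarith⟩

end Core

/-! ## §2 The member bound and the upper half from the CORE fact -/

section Facts

/-- `L(W,1) ≠ 0` forces analytic rank `0` (junk branch included). [cite: BirchSwinnertonDyer1965] -/
private theorem analyticRank_eq_zero_of_L_one_ne_zero (W : WeierstrassCurve ℚ) [W.IsElliptic]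
    (hL : W.entireLFunction 1 ≠ 0) : W.analyticRank = 0 := by
  by_cases hE : W.HasEntireLFunction
  · exact (WeierstrassCurve.analyticRank_eq_zero_iff_holds (W := W) hE).mpr hL
  · exact W.analyticRank_eq_zero_of_not_hasEntireLFunction hE

/-- **THE SHARP MEMBER BOUND FROM THE CORE FACT**: granted `nonempty_iwasawaH1Data`, `exists_isNewformOf`, Poitou–Tate over `ℚ`, GZK (for `W(ℚ)` finite
at `L(W,1) ≠ 0`) and `exists_memberHullZetaCoreInputs`, for `W/ℚ` globally minimal, `p ≠ 2` additive potentially good, `W[p]` reducible, `L(W,1) ≠ 0`,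
`Ш(W)` finite, Kato's member `W' ∼ W` satisfies `ord_p #Ш(W')[p^∞] + v_p Tam(W') ≤ ord_p(L(W',1)/Ω(W')) + 2·ord_p #W'(ℚ)_tors`.  Proof:
`ZetaBody` datum ⟶ cyclotomic `κ`, `γ` (PROVED existence) ⟶ `I` ⟶ the pinned lift `𝐲` ⟶ the core package `Z` ⟶ `Z.sha_add_tamagawa_le_of_PT`.
[cite: Kato2004Asterisque, proof of Prop. 14.16 (pp. 244–245), §14.14 and Lemma 14.15 (pp. 243–244), Thm. 12.6 (p. 222)]
[cite: GreenbergLNM1716, §3 and appendix to §4] [cite: Wuthrich2014, Lemma 14 (p. 396)] [cite: Darmon2004, Thm. 3.22] -/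
theorem katoMemberShaBoundSharp_of_coreInputs (hne : Kato2004.nonempty_iwasawaH1Data)
    (hmod : exists_isNewformOf) (hPT : poitouTate_selmerStructure_duality ℚ)
    (hGZK : rank_eq_analyticRank_of_analyticRank_le_one) (hin : Kato2004.exists_memberHullZetaCoreInputs)
    (W : WeierstrassCurve ℚ) [W.IsElliptic] [W.IsGloballyMinimal] (p : ℕ) [Fact p.Prime]
    (hp : p ≠ 2) (hng : ¬ W.HasGoodReductionAtPrime p) (hnm : ¬ W.HasMultiplicativeReductionAtPrime p)
    (hj : 0 ≤ padicValRat p W.j) (hred : ¬ W.HasIrreducibleModPGaloisRep p)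
    (hL : W.entireLFunction 1 ≠ 0) (hfin : Finite W.sha) :
    ∃ (W' : WeierstrassCurve ℚ) (_ : W'.IsElliptic) (_ : W'.IsGloballyMinimal),
      IsIsogenous W W' ∧ Finite W'.sha ∧
      ∃ q : ℚ, W'.entireLFunction 1 / (W'.realPeriodRat : ℂ) = (q : ℂ) ∧
        (padicValNat p (Nat.card (AddCommGroup.primaryComponent W'.sha p)) : ℤ) +
            padicValNat p W'.tamagawaProduct ≤
          padicValRat p q + 2 * (padicValNat p W'.torsionOrder : ℤ) := by
  -- Kato's member `W'` and the fact's data at it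
  obtain ⟨W', hE', hM', hiso, hrest⟩ := hin W p hp hng hnm hj hred hL hfin
  haveI := hE'
  haveI := hM'
  haveI : ContinuousSMul ℤ_[p] (W'.tateModule p) := TateModule.continuousSMul_padicInt
  haveI : Module.Free ℤ_[p] (W'.tateModule p) := W'.module_free_tateModule_holds p
  haveI : Module.Finite ℤ_[p] (W'.tateModule p) := W'.module_finite_tateModule_holds p
  -- `W(ℚ)` finite (GZK at analytic rank `0`), transported along the isogeny; `Ш(W')` finite likewise
  have h0 : W.analyticRank = 0 := analyticRank_eq_zero_of_L_one_ne_zero W hL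
  obtain ⟨hrk, -⟩ := hGZK W (by rw [h0]; exact zero_le_one)
  rw [h0] at hrk
  haveI hWfin : Finite W.toAffine.Point := (W.mordellWeilRank_eq_zero_iff_finite).mp hrk
  haveI hW'fin : Finite W'.toAffine.Point := finite_point_of_isIsogenous hiso.symm_of_isElliptic hWfin
  have hfin' : Finite W'.sha := (IsIsogenous.shaFinite_iff_shaFinite hiso).mp hfin
  haveI : Finite W'.sha := hfin'
  -- a newform of `W` (modularity) and a family of complex embeddings of the cyclotomic fields
  haveI : NeZero (W.conductorNorm ℤ) := ⟨(W.conductorNorm_pos_holds).ne'⟩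
  obtain ⟨f, hf⟩ := hmod W
  obtain ⟨κ', Λ', c, d, a, A, z, x, -, -, -, -, hbody, hpack⟩ := hrest f hf (fun m => Classical.arbitrary _)
  -- the cyclotomic `ℤ_p`-tower with a topological generator (PROVED), the pinned `𝐇¹_Γ(T_pW')`, the lift `𝐲`
  obtain ⟨κ, hκ, γ, hγ, -⟩ := exists_isCyclotomic_isTopGenerator_isCyclotomicVariable_holds p
  obtain ⟨I⟩ := hne W' p κ γ hκ hγ
  obtain ⟨y, hy⟩ := (IwasawaH1Data.existsUnique_lift_of_zetaBody p W' hκ hp I f _ κ' Λ' c d a A z x hbody).exists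
  -- the core package at `(I, 𝐲)` and the sharp member inequality
  obtain ⟨Z⟩ := hpack κ γ hκ hγ I y hy
  exact ⟨W', hE', hM', hiso, hfin', Z.sha_add_tamagawa_le_of_PT hκ hγ hPT hp⟩

/-- **THE UPPER HALF ON EVERY REDUCIBLE ADDITIVE POTENTIALLY GOOD ROW OF ANALYTIC RANK `0` FROM THE CORE FACT**: granted `nonempty_iwasawaH1Data`,
`exists_isNewformOf`, Poitou–Tate over `ℚ`, `exists_memberHullZetaCoreInputs` and the named facts Cassels (`bsdRHS_eq_of_isIsogenous`), GZK, modularity: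
`MissingUpperBoundAt W p` for every globally minimal `W` with `p ≠ 2` additive potentially good, `W[p]` reducible and `r_an = 0`.  Proof: the sharp
member bound at `W' = W_K` is `ord_p #Ш(W') ≤ ord_p #Ш_an(W')` (bookkeeping `exists_shaAn_eq_of_exactCount`), transported to `W` by
`TwistComparison.missingUpperBoundAt_of_isIsogenous`.  Conditional; nothing asserted.
[cite: Kato2004Asterisque, proof of Prop. 14.16 (pp. 244–245), §14.14 (p. 243)] [cite: Cassels1965ArithmeticVIII] [cite: Miller2011LMS, Def. 1.1] -/
theorem missingUpperBoundAt_of_coreInputs (hne : Kato2004.nonempty_iwasawaH1Data)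
    (hmod : exists_isNewformOf) (hPT : poitouTate_selmerStructure_duality ℚ) (hin : Kato2004.exists_memberHullZetaCoreInputs)
    (hCassels : bsdRHS_eq_of_isIsogenous) (hGZK : rank_eq_analyticRank_of_analyticRank_le_one)
    (hmodL : hasEntireLFunction_rat)
    (W : WeierstrassCurve ℚ) [W.IsElliptic] [W.IsGloballyMinimal] (p : ℕ) [Fact p.Prime]
    (hp : p ≠ 2) (hng : ¬ W.HasGoodReductionAtPrime p) (hnm : ¬ W.HasMultiplicativeReductionAtPrime p)
    (hj : 0 ≤ padicValRat p W.j) (hred : ¬ W.HasIrreducibleModPGaloisRep p)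
    (hr : W.analyticRank = 0) : MissingUpperBoundAt W p := by
  have hL : W.entireLFunction 1 ≠ 0 := (W.analyticRank_eq_zero_iff_holds (hmodL W)).mp hr
  have hfin : Finite W.sha := (hGZK W (by rw [hr]; exact zero_le_one)).2
  obtain ⟨W', hE', hM', hiso, hfin', q, hq, hle⟩ :=
    katoMemberShaBoundSharp_of_coreInputs hne hmod hPT hGZK hin W p hp hng hnm hj hred hL hfin
  haveI := hE'
  haveI := hM'
  have hr' : W'.analyticRank = 0 := by rw [← analyticRank_eq_of_isIsogenous' hiso, hr]
  -- bookkeeping at `W'`: the slack `a ≥ 0` of the sharp inequality is the defect `ord Ш_an − ord Ш`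
  obtain ⟨q', hq', hv⟩ := exists_shaAn_eq_of_exactCount W' p hGZK hmodL hr' (b := 0)
    (a := padicValRat p q + 2 * (padicValNat p W'.torsionOrder : ℤ) -
      ((padicValNat p (Nat.card (AddCommGroup.primaryComponent W'.sha p)) : ℤ) +
        padicValNat p W'.tamagawaProduct)) hq (by ring)
  have hup' : MissingUpperBoundAt W' p := ⟨q', hq', by rw [hv]; linarith⟩
  exact TwistComparison.missingUpperBoundAt_of_isIsogenous W' W p hCassels hGZK hmodL
    hiso.symm_of_isElliptic (by rw [hr']; exact zero_le_one) hup'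


/-- **The upper half from the CORE fact with Poitou–Tate DISCHARGED**: `nonempty_iwasawaH1Data`, `exists_isNewformOf`, `exists_memberHullZetaCoreInputs`,
Cassels, GZK, modularity ⟹ `MissingUpperBoundAt W p` on every reducible additive potentially good row of analytic rank `0`.
[cite: Kato2004Asterisque, proof of Prop. 14.16 (pp. 244–245), §14.14 (p. 243)] [cite: Cassels1965ArithmeticVIII] -/
theorem missingUpperBoundAt_of_coreInputs' (hne : Kato2004.nonempty_iwasawaH1Data)
    (hmod : exists_isNewformOf) (hin : Kato2004.exists_memberHullZetaCoreInputs)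
    (hCassels : bsdRHS_eq_of_isIsogenous) (hGZK : rank_eq_analyticRank_of_analyticRank_le_one)
    (hmodL : hasEntireLFunction_rat)
    (W : WeierstrassCurve ℚ) [W.IsElliptic] [W.IsGloballyMinimal] (p : ℕ) [Fact p.Prime]
    (hp : p ≠ 2) (hng : ¬ W.HasGoodReductionAtPrime p) (hnm : ¬ W.HasMultiplicativeReductionAtPrime p)
    (hj : 0 ≤ padicValRat p W.j) (hred : ¬ W.HasIrreducibleModPGaloisRep p)
    (hr : W.analyticRank = 0) : MissingUpperBoundAt W p :=
  missingUpperBoundAt_of_coreInputs hne hmod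
    (poitouTate_selmerStructure_duality_of_conj (InputsPoitouTateSelmer.poitouTate_selmerStructure_duality_conj_holds ℚ))
    hin hCassels hGZK hmodL W p hp hng hnm hj hred hr

/-- **The upper half from the PRINT-EXACT (Kummer-form) package** `exists_memberHullZetaKummerCoreInputs` (p637289), through g22's kernel bridge
`exists_memberHullZetaCoreInputs_of_kummerCoreInputs`, Poitou–Tate discharged. [cite: Kato2004Asterisque, Prop. 14.16 (2) (p. 244) and Lemma 14.18 (pp. 247–248)] -/
theorem missingUpperBoundAt_of_kummerCoreInputs (hne : Kato2004.nonempty_iwasawaH1Data)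
    (hmod : exists_isNewformOf) (hin : Kato2004.exists_memberHullZetaKummerCoreInputs)
    (hCassels : bsdRHS_eq_of_isIsogenous) (hGZK : rank_eq_analyticRank_of_analyticRank_le_one)
    (hmodL : hasEntireLFunction_rat)
    (W : WeierstrassCurve ℚ) [W.IsElliptic] [W.IsGloballyMinimal] (p : ℕ) [Fact p.Prime]
    (hp : p ≠ 2) (hng : ¬ W.HasGoodReductionAtPrime p) (hnm : ¬ W.HasMultiplicativeReductionAtPrime p)
    (hj : 0 ≤ padicValRat p W.j) (hred : ¬ W.HasIrreducibleModPGaloisRep p)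
    (hr : W.analyticRank = 0) : MissingUpperBoundAt W p :=
  missingUpperBoundAt_of_coreInputs' hne hmod
    (MemberHullZetaCoreInputsOfKummer.exists_memberHullZetaCoreInputs_of_kummerCoreInputs hin) hCassels hGZK hmodL W p hp hng hnm hj hred hr

end Facts

end Summit.BirchSwinnertonDyer.BirchSwinnertonDyer.Theorems.ReducibleUpperOfCoreInputs

end
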